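import Summits.AtomisticToContinuum.HydrodynamicLimit.Theorems.OneFlightGossipEngineEquilibriumClampedCollisionalWindowLDDefs
import Literature.Analysis.FluidPDE.HardSphereTranslation

/-!
# Translation covariance of a torus hard-sphere flow, in the vocabulary of the line `coarse-coin-entropy-chain`
(crux `EquilibriumClampedCollisionalWindowLD`, stmt-AtomisticToContinuum-13733; statics half, wave 1 / W1 — registered
stubs `isHardSphereTrajectory_translate`, `volume_translate_measurePreserving`, `liouville_translate_measurePreserving`,
`flow_translate_ae_forall`, `flow_translate_ae`)

Support file (`--supports stmt-AtomisticToContinuum-13733`) in the vocabulary of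
`Theorems/OneFlightGossipEngineEquilibriumClampedCollisionalWindowLDDefs` (namespace
`Summit.AtomisticToContinuum.HydrodynamicLimit.Theorems.ClampedTransferCoin`). Let
`T_h z = fun i => ((z i).1 + h, (z i).2)` be the diagonal position translation by `h` of a configuration of `n`
spheres on the flat torus `UnitAddTorus d`. The five registered signatures of the line are landed here verbatim, as
corollaries of the tree's `Literature.Analysis.FluidPDE.HardSphereTranslation` (which proves the homogeneity of the
torus hard-sphere dynamics under the name `posShift`; nothing is restated):

* `isHardSphereTrajectory_translate` — the translate of a hard-sphere trajectory is a hard-sphere trajectory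
  (`IsHardSphereTrajectory.posShift`: separation vectors `reprSym (x - y)`, the domain, contact sets, collision times and
  the incoming condition are `T_h`-invariant; free flight and the collision law commute with `T_h`; left limits are
  mapped by continuity of `T_h`);
* `volume_translate_measurePreserving` / `liouville_translate_measurePreserving` — `T_h` preserves Lebesgue measure on
  `(T^d × ℝ^d)^n` (Haar invariance factor by factor) and the Liouville measure `volume.restrict D_ε^n`
  (`HardSphereFlow.measurePreserving_posShift_volume`, `HardSphereFlow.measurePreserving_posShift_liouville`);
* `flow_translate_ae_forall` — for an ARBITRARY `HardSphereFlow (Torus.geometry d) ε n` (hypothesis structure; its good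
  set need not be `T_h`-invariant): for Liouville-a.e. `z`, `Φ_t (T_h z) = T_h (Φ_t z)` for all `t ≥ 0` AT ONCE (a.e.
  `z` and `T_h z` are good, `HardSphereFlow.ae_posShift_mem_good`; both sides are hard-sphere trajectories issued from
  `T_h z`, forward uniqueness `IsHardSphereTrajectory.unique_holds`, packaged as `HardSphereFlow.flow_posShift_of_nonneg`);
* `flow_translate_ae` — the same at every fixed `t ∈ ℝ` (`HardSphereFlow.flow_posShift_ae`; for `t < 0` the group
  property reduces to the forward statement at the good point `Φ_t z`).

Sources: Gallagher–Saint-Raymond–Texier 2013 §1.1, §4.1 (Prop. 4.1.1), §4.2; Cercignani–Illner–Pulvirenti 1994 §4.2.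
prover-line-stmt-AtomisticToContinuum-13733-c4-0, 2026-08-16.
-/

noncomputable section

open MeasureTheory ProbabilityTheory Set Filter
open scoped ENNReal BigOperators
open Literature.Analysis.FluidPDE Literature.MathematicalPhysics.KineticTheory
open Literature.Analysis.FunctionSpaces (Torus.partialDeriv Torus.IsSmooth)

namespace Summit.AtomisticToContinuum.HydrodynamicLimit.Theorems.ClampedTransferCoin

/-- **Registered stub `isHardSphereTrajectory_translate`.** The diagonal position translation of a hard-sphere
trajectory on the flat torus is a hard-sphere trajectory (homogeneity of the dynamics, GST 2013 §4.1; the tree's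
`IsHardSphereTrajectory.posShift`). -/
theorem isHardSphereTrajectory_translate {d : Type} [Fintype d] {ε : ℝ} {n : ℕ}
    {γ : ℝ → Config n d (UnitAddTorus d)} (hγ : IsHardSphereTrajectory (Torus.geometry d) ε n γ)
    (h : UnitAddTorus d) :
    IsHardSphereTrajectory (Torus.geometry d) ε n (fun t i => ((γ t i).1 + h, (γ t i).2)) :=
  hγ.posShift h

/-- **Registered stub `volume_translate_measurePreserving`.** The diagonal translation preserves Lebesgue measure on
the phase space `(T^d × ℝ^d)^n` (Haar measure of `T^d` is translation invariant, identity on the velocities, product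
over the labels; the tree's `HardSphereFlow.measurePreserving_posShift_volume`). -/
theorem volume_translate_measurePreserving {d : Type} [Fintype d] (n : ℕ) (h : UnitAddTorus d) :
    MeasurePreserving (fun (z : Config n d (UnitAddTorus d)) (i : Fin n) => ((z i).1 + h, (z i).2))
      volume volume :=
  HardSphereFlow.measurePreserving_posShift_volume (N := n) h

/-- **Registered stub `liouville_translate_measurePreserving`.** The diagonal translation preserves the Liouville
measure `volume.restrict D_ε^n` of `n` spheres of diameter `ε` on the torus (it preserves `volume` and the hard-sphere
domain; the tree's `HardSphereFlow.measurePreserving_posShift_liouville`). -/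
theorem liouville_translate_measurePreserving {d : Type} [Fintype d] (n : ℕ) (ε : ℝ) (h : UnitAddTorus d) :
    MeasurePreserving (fun (z : Config n d (UnitAddTorus d)) (i : Fin n) => ((z i).1 + h, (z i).2))
      (liouville (Torus.geometry d) n ε) (liouville (Torus.geometry d) n ε) :=
  HardSphereFlow.measurePreserving_posShift_liouville (N := n) (ε := ε) h

/-- **Registered stub `flow_translate_ae_forall`.** Translation covariance of an arbitrary torus hard-sphere flow at
all forward times simultaneously: for Liouville-a.e. `z`, `Φ_t (T_h z) = T_h (Φ_t z)` for every `t ≥ 0` (a.e. both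
`z` and `T_h z` are good, `HardSphereFlow.ae_posShift_mem_good`; on such `z` the two sides are hard-sphere trajectories
issued from `T_h z`, hence agree at all forward times by forward uniqueness, `HardSphereFlow.flow_posShift_of_nonneg`). -/
theorem flow_translate_ae_forall {d : Type} [Fintype d] {ε : ℝ} {n : ℕ}
    (Φ : HardSphereFlow (Torus.geometry d) ε n) (h : UnitAddTorus d) :
    ∀ᵐ z ∂(liouville (Torus.geometry d) n ε), ∀ t : ℝ, 0 ≤ t →
      Φ.flow t (fun i => ((z i).1 + h, (z i).2)) = fun i => ((Φ.flow t z i).1 + h, (Φ.flow t z i).2) := by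
  filter_upwards [Φ.ae_mem_good, Φ.ae_posShift_mem_good h] with z hz hTz t ht
  exact Φ.flow_posShift_of_nonneg h hz hTz ht

/-- **Registered stub `flow_translate_ae`.** Translation covariance of an arbitrary torus hard-sphere flow,
Liouville-almost everywhere, at every fixed time `t ∈ ℝ`: `Φ_t (T_h z) = T_h (Φ_t z)` for a.e. `z` (the tree's
`HardSphereFlow.flow_posShift_ae`: for `t ≥ 0` as above; for `t < 0` moreover a.e. `T_h (Φ_t z)` is good, by
invariance of the Liouville measure under `Φ_t` and `T_h`, and the group property reduces to the forward case at the
good point `Φ_t z`). -/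
theorem flow_translate_ae {d : Type} [Fintype d] {ε : ℝ} {n : ℕ}
    (Φ : HardSphereFlow (Torus.geometry d) ε n) (h : UnitAddTorus d) (t : ℝ) :
    ∀ᵐ z ∂(liouville (Torus.geometry d) n ε),
      Φ.flow t (fun i => ((z i).1 + h, (z i).2)) = fun i => ((Φ.flow t z i).1 + h, (Φ.flow t z i).2) :=
  Φ.flow_posShift_ae h t

end Summit.AtomisticToContinuum.HydrodynamicLimit.Theorems.ClampedTransferCoin

end
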